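import Literature.Analysis.FluidPDE.ExtremeGrowthVorticityControlProofs
import HarnessLib

/-!
# `‖S‖₂² = ½‖ω‖₂² = ½‖∇u‖₂² = ℰ` for divergence-free fields on the torus — PROVED

Analysis/FluidPDE proof file (theorems only: no definitions, no named facts). For a smooth
divergence-free field `u : T^d → ℝ^d` (any dimension), with `Gᵢⱼ = (∂ⱼu)ᵢ`, `S = ½(G + Gᵀ)`:

* `integral_sum_partialDeriv_swap_mul_eq_zero` — `∫ tr (G²) = ∫ ∑ᵢⱼ (∂ⱼu)ᵢ (∂ᵢu)ⱼ = 0`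
  (one integration by parts and `div u = 0`: `∑ⱼ(∂ⱼu)ᵢ(∂ᵢu)ⱼ = ∑ⱼ ∂ⱼ(uᵢ(∂ᵢu)ⱼ) − uᵢ∂ᵢ(div u)`);
* `integral_strainNormSq_eq_torusEnstrophy` — `∫ |S|² = ∫ ∑ᵢⱼ Sᵢⱼ² = ℰ(u) = ½‖∇u‖₂²`
  (`torusEnstrophy`), Miller's Hilbert-space isometry at `α = 0`
  ("`‖S‖²_{Ḣ^α} = ‖A‖²_{Ḣ^α} = ½‖ω‖²_{Ḣ^α} = ½‖∇⊗u‖²_{Ḣ^α}` for all `u` divergence free",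
  Miller, ARMA 235 (2020), Prop. 3.1, stated on `ℝ³` via Fourier; here on `T^d` by integration by parts);
* `integral_torusVorticitySqAt_eq_two_mul_torusEnstrophy` — `∫ |ω|² = ‖∇u‖₂² = 2ℰ(u)` with the
  tree's orientation-free `torusVorticitySqAt u x = ½∑ᵢⱼ((∂ᵢu)ⱼ − (∂ⱼu)ᵢ)²` (`= |∇×u|²` in 3D):
  Ayala–Protas 2017, eq. (2.4) "`∫_Ω |∇×u|² dx = ∫_Ω |∇u|² dx`" for periodic divergence-free fields
  — the identity the docstring of `torusVorticitySqAt_le_two_mul_sum_norm_sq` records as not yet done.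

These close the normalisation bookkeeping of the functional-mining cell (pub-nsfunc; DICTIONARY
§2: `ℰ = Z/2 = ‖S‖₂²`), and let the strain-form enstrophy bounds (`MillerStrainDeterminantBound`)
be read with `‖S‖₂² = ℰ`.

## Mathlib / tree search

Tree: `Torus.integral_partialDeriv_eq_zero_holds` (`∫∂ᵢf = 0`), `Torus.partialDeriv_mul`,
`Torus.partialDeriv_apply_coord`, `Torus.partialDeriv_comm`, `Torus.partialDeriv_finset_sum`,
`Torus.divergence_eq_sum_partialDeriv_apply`, `DoeringGibbon1995.torus_partialDeriv_const`,
`torusEnstrophy`, `Torus.gradNormSq`, `torusVorticitySqAt`. `lean search 'curl.*gradNormSq|strainNormSq'`: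
nothing on the torus.

## References

* E. Miller, Arch. Ration. Mech. Anal. 235 (2020) 99–139 = arXiv:1710.05569, Prop. 3.1 (held text p. 10). [Miller2019]
* D. Ayala, B. Protas, J. Fluid Mech. 818 (2017) 772–806 = arXiv:1605.05742, eq. (2.4) (held text p. 5). [AyalaProtas2017]
-/

noncomputable section

open Set MeasureTheory Finset
open scoped InnerProductSpace RealInnerProductSpace

namespace Literature.Analysis.FluidPDE

open Literature.Analysis.FunctionSpaces

variable {d : Type*} [Fintype d] [DecidableEq d]

/-- **`∫_{T^d} tr ((∇u)²) = 0`** for a smooth divergence-free field: `∫ ∑ᵢⱼ (∂ⱼu)ᵢ (∂ᵢu)ⱼ = 0`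
(`∑ⱼ (∂ⱼu)ᵢ(∂ᵢu)ⱼ = ∑ⱼ ∂ⱼ(uᵢ (∂ᵢu)ⱼ)` because `∑ⱼ ∂ⱼ(∂ᵢu)ⱼ = ∂ᵢ div u = 0`, and `∫∂ⱼ(·) = 0`).
[cite: Miller2019, Prop. 3.1 (proof, α = 0)] -/
theorem integral_sum_partialDeriv_swap_mul_eq_zero {u : UnitAddTorus d → EuclideanSpace ℝ d}
    (hu : Torus.IsSmooth u) (hdiv : Torus.IsDivFree u) :
    ∫ x, ∑ i, ∑ j, Torus.partialDeriv j u x i * Torus.partialDeriv i u x j = 0 := by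
  have hu1 : Torus.IsContDiff 1 u := hu.isContDiff (by simp)
  have hD : ∀ m, Torus.IsSmooth (Torus.partialDeriv m u) := fun m => hu.partialDeriv m
  have hD1 : ∀ m, Torus.IsContDiff 1 (Torus.partialDeriv m u) := fun m =>
    (hD m).isContDiff (by simp)
  have hDc : ∀ m j, Torus.IsSmooth (fun y => Torus.partialDeriv m u y j) := fun m j => (hD m).apply j
  have hDc1 : ∀ m j, Torus.IsContDiff 1 (fun y => Torus.partialDeriv m u y j) := fun m j =>
    (hDc m j).isContDiff (by simp)
  have huc : ∀ i, Torus.IsSmooth (fun y => u y i) := fun i => hu.apply i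
  have huc1 : ∀ i, Torus.IsContDiff 1 (fun y => u y i) := fun i => (huc i).isContDiff (by simp)
  have hψ : ∀ i j, Torus.IsSmooth (fun y => u y i * Torus.partialDeriv i u y j) := by
    intro i j
    have h : Torus.IsSmooth (fun y => u y i * Torus.partialDeriv i u y j) := (huc i).mul (hDc i j)
    exact h
  have hcomm : ∀ j m k x, Torus.partialDeriv j (fun y => Torus.partialDeriv m u y k) x =
      Torus.partialDeriv m (fun y => Torus.partialDeriv j u y k) x := by
    intro j m k x
    rw [Torus.partialDeriv_apply_coord (hD1 m), Torus.partialDeriv_apply_coord (hD1 j),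
      Torus.partialDeriv_comm hu j m x]
  -- pointwise: `∑ⱼ (∂ⱼu)ᵢ (∂ᵢu)ⱼ = ∑ⱼ ∂ⱼ(uᵢ (∂ᵢu)ⱼ)`
  have hA : ∀ i x, ∑ j, Torus.partialDeriv j u x i * Torus.partialDeriv i u x j =
      ∑ j, Torus.partialDeriv j (fun y => u y i * Torus.partialDeriv i u y j) x := by
    intro i x
    have hprod : ∀ j, Torus.partialDeriv j (fun y => u y i * Torus.partialDeriv i u y j) x =
        u x i * Torus.partialDeriv j (fun y => Torus.partialDeriv i u y j) x +
          Torus.partialDeriv j u x i * Torus.partialDeriv i u x j := by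
      intro j
      rw [Torus.partialDeriv_mul (huc1 i) (hDc1 i j), Torus.partialDeriv_apply_coord hu1]
    have hvan : ∑ j, Torus.partialDeriv j (fun y => Torus.partialDeriv i u y j) x = 0 := by
      simp_rw [show ∀ j, Torus.partialDeriv j (fun y => Torus.partialDeriv i u y j) x =
          Torus.partialDeriv i (fun y => Torus.partialDeriv j u y j) x from fun j => hcomm j i j x]
      rw [← Torus.partialDeriv_finset_sum Finset.univ (fun j _ => hDc1 j j)]
      have hdivfun : (fun y => ∑ j, Torus.partialDeriv j u y j) = fun _ => (0 : ℝ) := by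
        funext y
        rw [← Torus.divergence_eq_sum_partialDeriv_apply hu1]
        exact hdiv y
      rw [hdivfun, DoeringGibbon1995.torus_partialDeriv_const]
    simp_rw [hprod]
    rw [Finset.sum_add_distrib, ← Finset.mul_sum, hvan, mul_zero, zero_add]
  have hterm : ∀ i j, Integrable
      (fun x => Torus.partialDeriv j (fun y => u y i * Torus.partialDeriv i u y j) x) volume :=
    fun i j => ((hψ i j).partialDeriv j).integrable
  have hzero : ∀ i j,
      ∫ x, Torus.partialDeriv j (fun y => u y i * Torus.partialDeriv i u y j) x = 0 :=
    fun i j => Torus.integral_partialDeriv_eq_zero_holds (hψ i j) j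
  simp_rw [hA]
  rw [integral_finsetSum _ fun i _ => integrable_finsetSum _ fun j _ => hterm i j]
  refine Finset.sum_eq_zero fun i _ => ?_
  rw [integral_finsetSum _ fun j _ => hterm i j]
  exact Finset.sum_eq_zero fun j _ => hzero i j

/-- **`‖S‖₂² = ℰ`** (Miller, Prop. 3.1 at `α = 0`, torus form): for a smooth divergence-free field
on `T^d`, `∫ ∑ᵢⱼ Sᵢⱼ(x)² dx = torusEnstrophy u = ½‖∇u‖₂²`, `Sᵢⱼ = ½((∂ⱼu)ᵢ + (∂ᵢu)ⱼ)`
(pointwise `|S|² = ½|∇u|² + ½ tr (∇u)²`, and `∫ tr (∇u)² = 0`). [cite: Miller2019, Prop. 3.1] -/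
theorem integral_strainNormSq_eq_torusEnstrophy {u : UnitAddTorus d → EuclideanSpace ℝ d}
    (hu : Torus.IsSmooth u) (hdiv : Torus.IsDivFree u) :
    ∫ x, ∑ i, ∑ j, ((Torus.partialDeriv j u x i + Torus.partialDeriv i u x j) / 2) ^ 2 =
      torusEnstrophy u := by
  have hD : ∀ m, Torus.IsSmooth (Torus.partialDeriv m u) := fun m => hu.partialDeriv m
  have hDc : ∀ m j, Torus.IsSmooth (fun y => Torus.partialDeriv m u y j) := fun m j => (hD m).apply j
  -- pointwise decomposition
  have hpt : ∀ x, ∑ i, ∑ j, ((Torus.partialDeriv j u x i + Torus.partialDeriv i u x j) / 2) ^ 2 =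
      2⁻¹ * (∑ i, ‖Torus.partialDeriv i u x‖ ^ 2) +
        2⁻¹ * ∑ i, ∑ j, Torus.partialDeriv j u x i * Torus.partialDeriv i u x j := by
    intro x
    have hnorm : ∀ i, ‖Torus.partialDeriv i u x‖ ^ 2 = ∑ j, Torus.partialDeriv i u x j ^ 2 := by
      intro i
      rw [EuclideanSpace.norm_sq_eq]
      exact Finset.sum_congr rfl fun j _ => by rw [Real.norm_eq_abs, sq_abs]
    simp_rw [hnorm]
    have hswap : ∑ i, ∑ j, Torus.partialDeriv j u x i ^ 2 = ∑ i, ∑ j, Torus.partialDeriv i u x j ^ 2 :=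
      Finset.sum_comm
    have hexp : ∑ i, ∑ j, ((Torus.partialDeriv j u x i + Torus.partialDeriv i u x j) / 2) ^ 2 =
        ∑ i, ∑ j, (4⁻¹ * Torus.partialDeriv j u x i ^ 2 + 4⁻¹ * Torus.partialDeriv i u x j ^ 2 +
          2⁻¹ * (Torus.partialDeriv j u x i * Torus.partialDeriv i u x j)) :=
      Finset.sum_congr rfl fun i _ => Finset.sum_congr rfl fun j _ => by ring
    rw [hexp]
    simp only [Finset.sum_add_distrib, ← Finset.mul_sum]
    rw [hswap]
    ring
  have hF : Torus.IsSmooth (fun x => ∑ i, ‖Torus.partialDeriv i u x‖ ^ 2) :=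
    Torus.isSmooth_sum_norm_sq_partialDeriv hu
  have hT : Torus.IsSmooth (fun x => ∑ i, ∑ j, Torus.partialDeriv j u x i * Torus.partialDeriv i u x j) := by
    have h : ∀ i j, Torus.IsSmooth (fun x => Torus.partialDeriv j u x i * Torus.partialDeriv i u x j) :=
      fun i j => (hDc j i).mul (hDc i j)
    unfold Torus.IsSmooth at h ⊢
    exact ContDiff.sum fun i _ => ContDiff.sum fun j _ => h i j
  simp_rw [hpt]
  rw [integral_add (hF.integrable.const_mul _) (hT.integrable.const_mul _), integral_const_mul,
    integral_const_mul, integral_sum_partialDeriv_swap_mul_eq_zero hu hdiv, mul_zero, add_zero]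
  rfl

/-- **`∫|ω|² = ‖∇u‖₂² = 2ℰ`** (Ayala–Protas 2017, eq. (2.4): `∫|∇×u|² = ∫|∇u|²` for periodic
divergence-free fields; Miller, Prop. 3.1: `‖S‖₂² = ½‖ω‖₂²`): for a smooth divergence-free field on
`T^d`, `∫ torusVorticitySqAt u = 2 · torusEnstrophy u`, where
`torusVorticitySqAt u x = ½∑ᵢⱼ((∂ᵢu)ⱼ − (∂ⱼu)ᵢ)²` (`= |∇×u(x)|²` when `card d = 3`).
[cite: AyalaProtas2017, eq. (2.4)] -/
theorem integral_torusVorticitySqAt_eq_two_mul_torusEnstrophy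
    {u : UnitAddTorus d → EuclideanSpace ℝ d} (hu : Torus.IsSmooth u) (hdiv : Torus.IsDivFree u) :
    ∫ x, torusVorticitySqAt u x = 2 * torusEnstrophy u := by
  have hD : ∀ m, Torus.IsSmooth (Torus.partialDeriv m u) := fun m => hu.partialDeriv m
  have hDc : ∀ m j, Torus.IsSmooth (fun y => Torus.partialDeriv m u y j) := fun m j => (hD m).apply j
  have hpt : ∀ x, torusVorticitySqAt u x =
      (∑ i, ‖Torus.partialDeriv i u x‖ ^ 2) -
        ∑ i, ∑ j, Torus.partialDeriv j u x i * Torus.partialDeriv i u x j := by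
    intro x
    have hnorm : ∀ i, ‖Torus.partialDeriv i u x‖ ^ 2 = ∑ j, Torus.partialDeriv i u x j ^ 2 := by
      intro i
      rw [EuclideanSpace.norm_sq_eq]
      exact Finset.sum_congr rfl fun j _ => by rw [Real.norm_eq_abs, sq_abs]
    simp_rw [hnorm]
    unfold torusVorticitySqAt
    have hswap : ∑ i, ∑ j, Torus.partialDeriv j u x i ^ 2 = ∑ i, ∑ j, Torus.partialDeriv i u x j ^ 2 :=
      Finset.sum_comm
    have hswap' : ∑ i, ∑ j, Torus.partialDeriv i u x j * Torus.partialDeriv j u x i =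
        ∑ i, ∑ j, Torus.partialDeriv j u x i * Torus.partialDeriv i u x j :=
      Finset.sum_congr rfl fun i _ => Finset.sum_congr rfl fun j _ => by ring
    have hexp : ∑ i, ∑ j, (Torus.partialDeriv i u x j - Torus.partialDeriv j u x i) ^ 2 =
        ∑ i, ∑ j, (Torus.partialDeriv i u x j ^ 2 + Torus.partialDeriv j u x i ^ 2 -
          2 * (Torus.partialDeriv j u x i * Torus.partialDeriv i u x j)) :=
      Finset.sum_congr rfl fun i _ => Finset.sum_congr rfl fun j _ => by ring
    rw [hexp]
    simp only [Finset.sum_add_distrib, Finset.sum_sub_distrib, ← Finset.mul_sum]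
    rw [hswap]
    ring
  have hF : Torus.IsSmooth (fun x => ∑ i, ‖Torus.partialDeriv i u x‖ ^ 2) :=
    Torus.isSmooth_sum_norm_sq_partialDeriv hu
  have hT : Torus.IsSmooth (fun x => ∑ i, ∑ j, Torus.partialDeriv j u x i * Torus.partialDeriv i u x j) := by
    have h : ∀ i j, Torus.IsSmooth (fun x => Torus.partialDeriv j u x i * Torus.partialDeriv i u x j) :=
      fun i j => (hDc j i).mul (hDc i j)
    unfold Torus.IsSmooth at h ⊢
    exact ContDiff.sum fun i _ => ContDiff.sum fun j _ => h i j
  simp_rw [hpt]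
  rw [integral_sub hF.integrable hT.integrable, integral_sum_partialDeriv_swap_mul_eq_zero hu hdiv,
    sub_zero, ← gradNormSq_eq_two_mul_torusEnstrophy]
  rfl

/-- **`‖S‖₂² = ½‖ω‖₂²`** on `T^d` for smooth divergence-free fields (Miller, Prop. 3.1 at `α = 0`).
[cite: Miller2019, Prop. 3.1] -/
theorem integral_strainNormSq_eq_half_integral_torusVorticitySqAt
    {u : UnitAddTorus d → EuclideanSpace ℝ d} (hu : Torus.IsSmooth u) (hdiv : Torus.IsDivFree u) :
    ∫ x, ∑ i, ∑ j, ((Torus.partialDeriv j u x i + Torus.partialDeriv i u x j) / 2) ^ 2 =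
      2⁻¹ * ∫ x, torusVorticitySqAt u x := by
  rw [integral_strainNormSq_eq_torusEnstrophy hu hdiv,
    integral_torusVorticitySqAt_eq_two_mul_torusEnstrophy hu hdiv]
  ring

end Literature.Analysis.FluidPDE
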